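import Summits.Ventures.HSemireg.WedgeHankelSiegelClassesStable

/-!
# Venture HSemireg — THE QUOTIENT OF TH-7's CLASS SPACE OF DEGREE `p^e` BY THE SIEGEL CLASSES, AS A LINEAR REPRESENTATION: it is `2`-dimensional with basis the images of
# `E_0`, `E_{p^e}`, and the induced endomorphism of every substitution `g = (α β; γ δ)` (`Submodule.mapQ`) has the FROBENIUS-TWISTED columns `(α^{p^e}, β^{p^e})`,
# `(γ^{p^e}, δ^{p^e})`, trace `(α+δ)^{p^e}` and determinant `(αδ − βγ)^{p^e}` (characteristic `p`; J8's congruences packaged as a `LinearMap` on the quotient)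

HONEST FRAMING. Part of the Lean index of the computation cell `pub-hsemireg` (seat p10 gen 21, Sunday typer «UNIFORM-IN-n»).
Finite-dimensional EXTERIOR ALGEBRA + linear algebra ONLY: no variety, no cohomology theory, no sheaf, no Ext group, no semiregularity map;
nothing here says that HC / HC_CM / HC_AV holds; no Literature fact is declared or used.  Custodian versions as in `WedgeHankelSiegelIdeal` (1/3) and `WedgeHankelFrameChange`;
the dictionary (`Sym^{p^e} V ↠ V^{[e]}`, the `e`-th Frobenius twist of the letters' plane, with kernel spanned by the inner monomials) is QUOTED, never asserted.

WHAT IS IN THE TREE.  J8 (`WedgeHankelSiegelClassesStable`): `Sb_mem_coSiegel_inf_siegelIdeal` (the Siegel classes are stable), `Sb_w_spike_zero_sub_mem_prime_pow` /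
`Sb_w_spike_top_sub_mem_prime_pow` (`Sb g E_0 ≡ α^{p^e}E_0 + β^{p^e}E_{p^e}`, `Sb g E_{p^e} ≡ γ^{p^e}E_0 + δ^{p^e}E_{p^e}` modulo them); J2 `finrank_coSiegel_inf_siegelIdeal_prime_pow`
(`= p^e − 1`); I19 `w_mem_siegelIdeal_iff`; I11 `spikeSpan`, `spikeBasis`, `SbC`.  Gen-20 OPEN (e) asked for the induced action on the quotient AS A `LinearMap`.  THIS FILE
(namespace `Summit.Ventures.HSemireg.Wedge.HankelFrameChange` continued; imports J8) supplies it, with the Siegel classes pulled back into `spikeSpan (p^e)` as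
`Submodule.comap (spikeSpan K (p^e)).subtype (coSiegel ⊓ SI)` (written inline; no definition):
* §283 `finrank_comap_siegel` (every `n`: the pull-back has the dimension of `coSiegel_n ⊓ SI_n`), **`finrank_quotient_comap_siegel_prime_pow`** (`n = p^e`: the quotient has
  dimension `2`), `smul_spike_zero_add_smul_spike_top_mem_siegelIdeal_iff` (`a•E_0 + b•E_n` is a Siegel form iff `a = b = 0`, every `n ≥ 1`),
  **`linearIndependent_mkQ_spike_pair`** (the images of `E_0`, `E_{p^e}` are independent in the quotient) — so they form a basis (`2 = dim`).
* §284 THE INDUCED ENDOMORPHISM `mapQ (SbC g)`: **`mapQ_SbC_mkQ_spike_zero`** (`= α^{p^e} • [E_0] + β^{p^e} • [E_{p^e}]`), **`mapQ_SbC_mkQ_spike_top`**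
  (`= γ^{p^e} • [E_0] + δ^{p^e} • [E_{p^e}]`), **`exists_basis_toMatrix_mapQ_SbC_prime_pow`** (in the basis `[E_0], [E_{p^e}]` the matrix is
  `(α^{p^e} γ^{p^e}; β^{p^e} δ^{p^e})`), **`trace_mapQ_SbC_prime_pow`** (`= α^{p^e} + δ^{p^e} = (α + δ)^{p^e}`), **`det_mapQ_SbC_prime_pow`** (`= α^{p^e}δ^{p^e} − β^{p^e}γ^{p^e} = (αδ − βγ)^{p^e}`) — the quotient
  representation is the `e`-th FROBENIUS TWIST of the degree-one class space (`sbMat_1(g) = gᵀ`).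
NOT typed here: general `n` (the quotient by the Siegel classes has dimension `Π(n_i+1)`, J15, and is expected irreducible — not typed); anything Ext-side.  New names only.
-/

open Module

namespace Summit.Ventures.HSemireg.Wedge.HankelFrameChange

open Summit.Ventures.HSemireg.Wedge Summit.Ventures.HSemireg.Wedge.Kunneth Summit.Ventures.HSemireg.Wedge.Hankel
  Summit.Ventures.HSemireg.Wedge.BasisFree Summit.Ventures.HSemireg.Wedge.HankelSiegel Summit.Ventures.HSemireg.Wedge.HankelSiegelIdeal
  Summit.Ventures.HSemireg.Wedge.KunnethKernel Summit.Ventures.HSemireg.Wedge.HankelRankOne Summit.Ventures.HSemireg.Wedge.KernelDuality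

variable (K : Type*) [Field K] {n : ℕ}

/-! ## §283. The quotient by the Siegel classes: dimension and a basis for `n = p^e` -/

/-- the pull-back of the Siegel classes into th-7's class space has the dimension of `coSiegel_n ⊓ SI_n` (it lies inside `coSiegel_n = spikeSpan n`). -/
theorem finrank_comap_siegel :
    finrank K ↥(Submodule.comap (spikeSpan K n).subtype (coSiegel K n n ⊓ siegelIdeal K n n)) = finrank K ↥(coSiegel K n n ⊓ siegelIdeal K n n) := by
  rw [← Submodule.finrank_map_subtype_eq (spikeSpan K n), Submodule.map_comap_subtype, inf_eq_right.mpr]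
  rw [spikeSpan_eq_coSiegel]; exact inf_le_left

/-- **`n = p^e` in characteristic `p`: the quotient of the class space by the Siegel classes has dimension `2`** (`(p^e + 1) − (p^e − 1)`, J2). -/
theorem finrank_quotient_comap_siegel_prime_pow (p : ℕ) [CharP K p] (hp : p.Prime) (e : ℕ) :
    finrank K (spikeSpan K (p ^ e) ⧸ Submodule.comap (spikeSpan K (p ^ e)).subtype (coSiegel K (p ^ e) (p ^ e) ⊓ siegelIdeal K (p ^ e) (p ^ e))) = 2 := by
  have h := Submodule.finrank_quotient_add_finrank (Submodule.comap (spikeSpan K (p ^ e)).subtype (coSiegel K (p ^ e) (p ^ e) ⊓ siegelIdeal K (p ^ e) (p ^ e)))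
  rw [finrank_comap_siegel, finrank_coSiegel_inf_siegelIdeal_prime_pow K p hp e, finrank_eq_card_basis (spikeBasis K (p ^ e)), Fintype.card_fin] at h
  have := Nat.one_le_pow e p hp.pos
  omega

/-- `a•E_0 + b•E_n = w_n(a·δ_0 + b·δ_n)`. -/
theorem smul_spike_zero_add_smul_spike_top (a b : K) :
    a • w K n n (fun j => if j = 0 then (1 : K) else 0) + b • w K n n (fun j => if j = n then (1 : K) else 0) =
      w K n n (fun j => a * (if j = 0 then (1 : K) else 0) + b * (if j = n then (1 : K) else 0)) := by
  rw [w_add, w_smul, w_smul]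

/-- **`a•E_0 + b•E_n` is a Siegel class iff `a = b = 0`** (`n ≥ 1`; `C(n,0) = C(n,n) = 1`, I19 `w_mem_siegelIdeal_iff`). -/
theorem smul_spike_zero_add_smul_spike_top_mem_siegelIdeal_iff (hn : 1 ≤ n) (a b : K) :
    a • w K n n (fun j => if j = 0 then (1 : K) else 0) + b • w K n n (fun j => if j = n then (1 : K) else 0) ∈ siegelIdeal K n n ↔ a = 0 ∧ b = 0 := by
  rw [smul_spike_zero_add_smul_spike_top, w_mem_siegelIdeal_iff]
  constructor
  · intro h
    have h0 := h 0 (Nat.zero_le n)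
    have hn' := h n le_rfl
    rw [if_pos rfl, if_neg (by omega), Nat.choose_zero_right, Nat.cast_one, one_mul, mul_one, mul_zero, add_zero] at h0
    rw [if_neg (by omega), if_pos rfl, Nat.choose_self, Nat.cast_one, one_mul, mul_one, mul_zero, zero_add] at hn'
    exact ⟨h0, hn'⟩
  · rintro ⟨rfl, rfl⟩ j _
    rw [zero_mul, zero_mul, add_zero, mul_zero]

/-- **the images `[E_0]`, `[E_{p^e}]` in the quotient by the Siegel classes are linearly independent** (hence a basis: the quotient has dimension `2`). -/
theorem linearIndependent_mkQ_spike_pair (p : ℕ) [CharP K p] (hp : p.Prime) (e : ℕ) :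
    LinearIndependent K ![(Submodule.comap (spikeSpan K (p ^ e)).subtype (coSiegel K (p ^ e) (p ^ e) ⊓ siegelIdeal K (p ^ e) (p ^ e))).mkQ
        ⟨w K (p ^ e) (p ^ e) (fun j => if j = 0 then (1 : K) else 0), w_mem_spikeSpan K _⟩,
      (Submodule.comap (spikeSpan K (p ^ e)).subtype (coSiegel K (p ^ e) (p ^ e) ⊓ siegelIdeal K (p ^ e) (p ^ e))).mkQ
        ⟨w K (p ^ e) (p ^ e) (fun j => if j = p ^ e then (1 : K) else 0), w_mem_spikeSpan K _⟩] := by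
  refine LinearIndependent.pair_iff.mpr fun a b hab => ?_
  rw [← map_smul, ← map_smul, ← map_add, Submodule.mkQ_apply, Submodule.Quotient.mk_eq_zero, Submodule.mem_comap, Submodule.subtype_apply,
    Submodule.coe_add, Submodule.coe_smul, Submodule.coe_smul] at hab
  exact (smul_spike_zero_add_smul_spike_top_mem_siegelIdeal_iff K (Nat.one_le_pow e p hp.pos) a b).mp hab.2

/-! ## §284. The induced endomorphism of a substitution on the quotient: the Frobenius twist -/

/-- **`mapQ (SbC g) [E_0] = α^{p^e} • [E_0] + β^{p^e} • [E_{p^e}]`** on the quotient of th-7's class space of degree `p^e` by the Siegel classes (J8's first congruence). -/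
theorem mapQ_SbC_mkQ_spike_zero (p : ℕ) [CharP K p] (hp : p.Prime) (e : ℕ) (α β γ δ : K) :
    Submodule.mapQ _ (Submodule.comap (spikeSpan K (p ^ e)).subtype (coSiegel K (p ^ e) (p ^ e) ⊓ siegelIdeal K (p ^ e) (p ^ e))) (SbC K α β γ δ)
        (fun _ hf => Sb_mem_coSiegel_inf_siegelIdeal K α β γ δ hf)
        ((Submodule.comap (spikeSpan K (p ^ e)).subtype (coSiegel K (p ^ e) (p ^ e) ⊓ siegelIdeal K (p ^ e) (p ^ e))).mkQ
          ⟨w K (p ^ e) (p ^ e) (fun j => if j = 0 then (1 : K) else 0), w_mem_spikeSpan K _⟩) =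
      α ^ p ^ e • (Submodule.comap (spikeSpan K (p ^ e)).subtype (coSiegel K (p ^ e) (p ^ e) ⊓ siegelIdeal K (p ^ e) (p ^ e))).mkQ
          ⟨w K (p ^ e) (p ^ e) (fun j => if j = 0 then (1 : K) else 0), w_mem_spikeSpan K _⟩ +
        β ^ p ^ e • (Submodule.comap (spikeSpan K (p ^ e)).subtype (coSiegel K (p ^ e) (p ^ e) ⊓ siegelIdeal K (p ^ e) (p ^ e))).mkQ
          ⟨w K (p ^ e) (p ^ e) (fun j => if j = p ^ e then (1 : K) else 0), w_mem_spikeSpan K _⟩ := by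
  rw [← map_smul, ← map_smul, ← map_add]
  simp only [Submodule.mkQ_apply]
  rw [Submodule.mapQ_apply, Submodule.Quotient.eq, Submodule.mem_comap, Submodule.subtype_apply, Submodule.coe_sub, SbC_apply_coe, Submodule.coe_add,
    Submodule.coe_smul, Submodule.coe_smul]
  exact Sb_w_spike_zero_sub_mem_prime_pow K p hp e α β γ δ

/-- **`mapQ (SbC g) [E_{p^e}] = γ^{p^e} • [E_0] + δ^{p^e} • [E_{p^e}]`** (J8's second congruence). -/
theorem mapQ_SbC_mkQ_spike_top (p : ℕ) [CharP K p] (hp : p.Prime) (e : ℕ) (α β γ δ : K) :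
    Submodule.mapQ _ (Submodule.comap (spikeSpan K (p ^ e)).subtype (coSiegel K (p ^ e) (p ^ e) ⊓ siegelIdeal K (p ^ e) (p ^ e))) (SbC K α β γ δ)
        (fun _ hf => Sb_mem_coSiegel_inf_siegelIdeal K α β γ δ hf)
        ((Submodule.comap (spikeSpan K (p ^ e)).subtype (coSiegel K (p ^ e) (p ^ e) ⊓ siegelIdeal K (p ^ e) (p ^ e))).mkQ
          ⟨w K (p ^ e) (p ^ e) (fun j => if j = p ^ e then (1 : K) else 0), w_mem_spikeSpan K _⟩) =
      γ ^ p ^ e • (Submodule.comap (spikeSpan K (p ^ e)).subtype (coSiegel K (p ^ e) (p ^ e) ⊓ siegelIdeal K (p ^ e) (p ^ e))).mkQ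
          ⟨w K (p ^ e) (p ^ e) (fun j => if j = 0 then (1 : K) else 0), w_mem_spikeSpan K _⟩ +
        δ ^ p ^ e • (Submodule.comap (spikeSpan K (p ^ e)).subtype (coSiegel K (p ^ e) (p ^ e) ⊓ siegelIdeal K (p ^ e) (p ^ e))).mkQ
          ⟨w K (p ^ e) (p ^ e) (fun j => if j = p ^ e then (1 : K) else 0), w_mem_spikeSpan K _⟩ := by
  rw [← map_smul, ← map_smul, ← map_add]
  simp only [Submodule.mkQ_apply]
  rw [Submodule.mapQ_apply, Submodule.Quotient.eq, Submodule.mem_comap, Submodule.subtype_apply, Submodule.coe_sub, SbC_apply_coe, Submodule.coe_add,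
    Submodule.coe_smul, Submodule.coe_smul]
  exact Sb_w_spike_top_sub_mem_prime_pow K p hp e α β γ δ

/-- **IN THE BASIS `[E_0], [E_{p^e}]` OF THE QUOTIENT THE MATRIX OF `mapQ (SbC g)` IS THE FROBENIUS TWIST `(α^{p^e} γ^{p^e}; β^{p^e} δ^{p^e})`** of th-7's degree-one matrix
`S_1(g) = gᵀ` — stated as the existence of a basis of the quotient with `b 0 = [E_0]`, `b 1 = [E_{p^e}]` and that matrix. -/
theorem exists_basis_toMatrix_mapQ_SbC_prime_pow (p : ℕ) [CharP K p] (hp : p.Prime) (e : ℕ) (α β γ δ : K) :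
    ∃ b : Basis (Fin 2) K (spikeSpan K (p ^ e) ⧸ Submodule.comap (spikeSpan K (p ^ e)).subtype (coSiegel K (p ^ e) (p ^ e) ⊓ siegelIdeal K (p ^ e) (p ^ e))),
      b 0 = (Submodule.comap (spikeSpan K (p ^ e)).subtype (coSiegel K (p ^ e) (p ^ e) ⊓ siegelIdeal K (p ^ e) (p ^ e))).mkQ
          ⟨w K (p ^ e) (p ^ e) (fun j => if j = 0 then (1 : K) else 0), w_mem_spikeSpan K _⟩ ∧
      b 1 = (Submodule.comap (spikeSpan K (p ^ e)).subtype (coSiegel K (p ^ e) (p ^ e) ⊓ siegelIdeal K (p ^ e) (p ^ e))).mkQ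
          ⟨w K (p ^ e) (p ^ e) (fun j => if j = p ^ e then (1 : K) else 0), w_mem_spikeSpan K _⟩ ∧
      LinearMap.toMatrix b b (Submodule.mapQ _ (Submodule.comap (spikeSpan K (p ^ e)).subtype (coSiegel K (p ^ e) (p ^ e) ⊓ siegelIdeal K (p ^ e) (p ^ e)))
        (SbC K α β γ δ) (fun _ hf => Sb_mem_coSiegel_inf_siegelIdeal K α β γ δ hf)) = !![α ^ p ^ e, γ ^ p ^ e; β ^ p ^ e, δ ^ p ^ e] := by
  have hcard : Fintype.card (Fin 2) =
      finrank K (spikeSpan K (p ^ e) ⧸ Submodule.comap (spikeSpan K (p ^ e)).subtype (coSiegel K (p ^ e) (p ^ e) ⊓ siegelIdeal K (p ^ e) (p ^ e))) := by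
    rw [Fintype.card_fin, finrank_quotient_comap_siegel_prime_pow K p hp e]
  refine ⟨basisOfLinearIndependentOfCardEqFinrank (linearIndependent_mkQ_spike_pair K p hp e) hcard, ?_, ?_, ?_⟩
  · rw [coe_basisOfLinearIndependentOfCardEqFinrank]; rfl
  · rw [coe_basisOfLinearIndependentOfCardEqFinrank]; rfl
  · set b := basisOfLinearIndependentOfCardEqFinrank (linearIndependent_mkQ_spike_pair K p hp e) hcard with hb
    have hb0 : b 0 = (Submodule.comap (spikeSpan K (p ^ e)).subtype (coSiegel K (p ^ e) (p ^ e) ⊓ siegelIdeal K (p ^ e) (p ^ e))).mkQ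
        ⟨w K (p ^ e) (p ^ e) (fun j => if j = 0 then (1 : K) else 0), w_mem_spikeSpan K _⟩ := by rw [hb, coe_basisOfLinearIndependentOfCardEqFinrank]; rfl
    have hb1 : b 1 = (Submodule.comap (spikeSpan K (p ^ e)).subtype (coSiegel K (p ^ e) (p ^ e) ⊓ siegelIdeal K (p ^ e) (p ^ e))).mkQ
        ⟨w K (p ^ e) (p ^ e) (fun j => if j = p ^ e then (1 : K) else 0), w_mem_spikeSpan K _⟩ := by rw [hb, coe_basisOfLinearIndependentOfCardEqFinrank]; rfl
    have hF0 : Submodule.mapQ _ (Submodule.comap (spikeSpan K (p ^ e)).subtype (coSiegel K (p ^ e) (p ^ e) ⊓ siegelIdeal K (p ^ e) (p ^ e)))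
        (SbC K α β γ δ) (fun _ hf => Sb_mem_coSiegel_inf_siegelIdeal K α β γ δ hf) (b 0) = α ^ p ^ e • b 0 + β ^ p ^ e • b 1 := by
      rw [hb0, hb1]; exact mapQ_SbC_mkQ_spike_zero K p hp e α β γ δ
    have hF1 : Submodule.mapQ _ (Submodule.comap (spikeSpan K (p ^ e)).subtype (coSiegel K (p ^ e) (p ^ e) ⊓ siegelIdeal K (p ^ e) (p ^ e)))
        (SbC K α β γ δ) (fun _ hf => Sb_mem_coSiegel_inf_siegelIdeal K α β γ δ hf) (b 1) = γ ^ p ^ e • b 0 + δ ^ p ^ e • b 1 := by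
      rw [hb0, hb1]; exact mapQ_SbC_mkQ_spike_top K p hp e α β γ δ
    ext i j
    rw [LinearMap.toMatrix_apply]
    fin_cases j
    · rw [show ((⟨0, by omega⟩ : Fin 2)) = 0 from rfl, hF0, map_add, map_smul, map_smul, b.repr_self, b.repr_self]
      fin_cases i
      · simp
      · simp
    · rw [show ((⟨1, by omega⟩ : Fin 2)) = 1 from rfl, hF1, map_add, map_smul, map_smul, b.repr_self, b.repr_self]
      fin_cases i
      · simp
      · simp

/-- **THE TRACE ON THE QUOTIENT: `tr mapQ(SbC g) = (α + δ)^{p^e}`** (`= α^{p^e} + δ^{p^e}`, the Frobenius twist of `tr g`). -/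
theorem trace_mapQ_SbC_prime_pow (p : ℕ) [CharP K p] (hp : p.Prime) (e : ℕ) (α β γ δ : K) :
    LinearMap.trace K _ (Submodule.mapQ _ (Submodule.comap (spikeSpan K (p ^ e)).subtype (coSiegel K (p ^ e) (p ^ e) ⊓ siegelIdeal K (p ^ e) (p ^ e)))
        (SbC K α β γ δ) (fun _ hf => Sb_mem_coSiegel_inf_siegelIdeal K α β γ δ hf)) = (α + δ) ^ p ^ e := by
  haveI : Fact p.Prime := ⟨hp⟩
  obtain ⟨b, -, -, hM⟩ := exists_basis_toMatrix_mapQ_SbC_prime_pow K p hp e α β γ δ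
  rw [LinearMap.trace_eq_matrix_trace K b, hM, Matrix.trace_fin_two_of, add_pow_char_pow]

/-- **THE DETERMINANT ON THE QUOTIENT: `det mapQ(SbC g) = (αδ − βγ)^{p^e}`** (`= α^{p^e}δ^{p^e} − β^{p^e}γ^{p^e}`, the Frobenius twist of `det g`). -/
theorem det_mapQ_SbC_prime_pow (p : ℕ) [CharP K p] (hp : p.Prime) (e : ℕ) (α β γ δ : K) :
    LinearMap.det (Submodule.mapQ _ (Submodule.comap (spikeSpan K (p ^ e)).subtype (coSiegel K (p ^ e) (p ^ e) ⊓ siegelIdeal K (p ^ e) (p ^ e)))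
        (SbC K α β γ δ) (fun _ hf => Sb_mem_coSiegel_inf_siegelIdeal K α β γ δ hf)) = (α * δ - β * γ) ^ p ^ e := by
  haveI : Fact p.Prime := ⟨hp⟩
  obtain ⟨b, -, -, hM⟩ := exists_basis_toMatrix_mapQ_SbC_prime_pow K p hp e α β γ δ
  rw [← LinearMap.det_toMatrix b, hM, Matrix.det_fin_two_of, sub_pow_char_pow, mul_pow, mul_pow, mul_comm (γ ^ p ^ e)]

end Summit.Ventures.HSemireg.Wedge.HankelFrameChange
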